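import Summits.QuantumAdvantage.QuantumAdvantage.Theorems.RingSymmetrization3
import Summits.QuantumAdvantage.QuantumAdvantage.Theorems.MultiRingBridge
import Summits.QuantumAdvantage.QuantumAdvantage.Theorems.ExactnessDialOddToAll

/-!
# The symmetrisation law: `PolyLossOddU3` for one covariant polynomial

Cell decomp-qadv, seat lens-2 («structural dichotomy: special vs generic»), generation 12 — LAND-READY tree
twin of the node `HOME/decomp-qadv-lens-2/g12/LeaderDial.lean` (node sha256 ef4b277d…; farm rc 0 · 0 sorries ·
axioms {propext, Classical.choice, Quot.sound}).  Explicit binders, no new `Prop` items; `decide` is used only on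
closed `ZMod 3` literals.

THE SYMMETRISATION LAW (one-polynomial normal form of the junction item `ExactnessDial.PolyLossOddU3`,
stmt-QuantumAdvantage-26531):

  `polyLossOddU3_iff_cov : PolyLossOddU3 ↔ ∃ C, ∀ c, ∃ n₀, ∀ n ≥ n₀, ∀ Q ∈ lowDeg (ZMod 3) n ((log₂ n)^c),
      #{x | OddZeros x ∧ Rel x (cov Q x)} ≤ (1 − n^(−C))·2^(n−1)`

— at the inverse-polynomial-loss / polylog-degree grade the adversary is WLOG ONE rotation-COVARIANT polynomial
(`RingPeriodFold.cov`).  Easy direction: restriction to `covStrat Q` (same exponent).  Hard direction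
(`polyLossOddU3_of_cov`, exponent `C ↦ C+1`, degree exponent `c ↦ max c 4 + 1`, threshold
`n ≥ max n₀ 2^(2C+11)`): `𝔽₃` leader election with `t = (C+3)(L+1)+1` trials, window `ℓ = (C+4)(L+1)+1`,
failure divisor `M = n^(C+1)` (`L = log₂ n`; `election_params`), then `symmetrization3`.
Corollaries: `noPerfectOdd3_of_polyLossOddU3` (26531 ⟹ 26532, the odd class has `≥ 2^(n−1)` patterns), and
ExactnessDial's `closes` with the `NoPerfectOdd3` and bridge binders discharged and the junction read for ONE
covariant polynomial (`exactnessDial_closes_cov`); **item 26534 `OddToAll3` PROVED** (`exactnessDial_oddToAll3`,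
the odd ⟹ all dictionary) and `exactnessDial_closes₂ : PolyLossOddU3 → DPLift3 → AdviceFreeQNC0Three`.
-/

set_option linter.dupNamespace false

noncomputable section

open scoped Classical

namespace Summit.QuantumAdvantage.QuantumAdvantage.Theorems

open Finset
open Literature.Computability.QuantumComplexity Literature.Computability.QuantumComplexity.RingHLF
open Literature.Computability.MetaComplexity Literature.Computability.MetaComplexity.Smolensky
open Summit.QuantumAdvantage.AdviceFreeQNC0
open Summit.QuantumAdvantage.AdviceFreeQNC0.RingSymmetry
open Summit.QuantumAdvantage.AdviceFreeQNC0.LeaderElection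
open Summit.QuantumAdvantage.QuantumAdvantage.Theorems.RingPeriodFold (cov covStrat covLosing
  mem_covLosing covStrat_mem_lowDeg cov_eq_covStrat ind_rot_mem')

namespace RingSymmetrization3

open Summit.QuantumAdvantage.QuantumAdvantage.Theorems.ExactnessDialOddToAll

/-! ### Restriction: the junction implies its covariant reading -/

/-- the odd-class win count of the covariant rule of `Q` is that of the strategy `covStrat Q`. -/
theorem filter_cov_eq {n : ℕ} (Q : CubeFn (ZMod 3) n) :
    (univ.filter fun x : Fin n → Bool => OddZeros x ∧ RingHLF.Rel x (cov Q x)) =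
      univ.filter fun x : Fin n → Bool =>
        OddZeros x ∧ RingHLF.Rel x (fun i => decide (covStrat Q i x = 1)) := by
  rfl


/-- EASY DIRECTION (restriction, same exponent): the junction 26531 bounds in particular the covariant
strategy `covStrat Q` of one polynomial. -/
theorem cov_of_polyLossOddU3 (h : Theses.ExactnessDial.PolyLossOddU3) :
    ∃ C : ℕ, ∀ c : ℕ, ∃ n₀ : ℕ, ∀ n ≥ n₀, ∀ Q : CubeFn (ZMod 3) n,
      Q ∈ lowDeg (ZMod 3) n ((Nat.log 2 n) ^ c) →
        ((univ.filter fun x : Fin n → Bool => OddZeros x ∧ RingHLF.Rel x (cov Q x)).card : ℝ) ≤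
          (1 - 1 / (n : ℝ) ^ C) * (2 : ℝ) ^ (n - 1) := by
  obtain ⟨C, hC⟩ := h
  refine ⟨C, fun c => ?_⟩
  obtain ⟨n₀, hn₀⟩ := hC c
  refine ⟨n₀, fun n hn Q hQ => ?_⟩
  rw [filter_cov_eq]
  exact hn₀ n hn (covStrat Q) (covStrat_mem_lowDeg hQ)


/-! ### The odd class has `2^(n−1)` patterns (lower bound), so polynomial loss forbids perfection -/

/-! ### The law: `CovPolyLossOddU3 → PolyLossOddU3` by leader election and symmetrisation -/

/-- the parameter bookkeeping of the `𝔽₃` election at failure divisor `M = n^(C+1)`: for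
`n ≥ 2^(2C+11)` with `L = log₂ n`, `t = (C+3)(L+1)+1`, `ℓ = (C+4)(L+1)+1` satisfy `2ℓ ≤ n`,
`2n²M ≤ 2^t`, `2n³M ≤ 2^ℓ` and `4tℓ ≤ L^4`. -/
theorem election_params (C n : ℕ) (hn : 2 ^ (2 * C + 11) ≤ n) :
    let L := Nat.log 2 n
    let t := (C + 3) * (L + 1) + 1
    let ℓ := (C + 4) * (L + 1) + 1
    2 * ℓ ≤ n ∧ 2 * n ^ 2 * n ^ (C + 1) ≤ 2 ^ t ∧ 2 * n ^ 3 * n ^ (C + 1) ≤ 2 ^ ℓ ∧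
      t * (2 * (2 * ℓ)) ≤ L ^ 4 := by
  intro L t ℓ
  have hn0 : 0 < n := lt_of_lt_of_le (by positivity) hn
  have hL : 2 * C + 11 ≤ L := Nat.le_log_of_pow_le (by norm_num) hn
  have hnL : n < 2 ^ (L + 1) := Nat.lt_pow_succ_log_self (by norm_num) n
  have hLn : 2 ^ L ≤ n := Nat.pow_log_le_self 2 (by omega)
  -- the key quadratic bound `2(C+5)(L+1) ≤ L²`
  have hkey : 2 * (C + 5) * (L + 1) ≤ L ^ 2 := by
    have h1 : 2 * (C + 5) + 1 ≤ L := by omega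
    nlinarith
  have hsq : L ^ 2 ≤ 2 ^ L := by
    -- `m² ≤ 2^m` for `m ≥ 4` (inlined; the stand-alone lemma is `OddZeta.sq_le_two_pow` in Literature)
    have key : ∀ m : ℕ, 4 ≤ m → m ^ 2 ≤ 2 ^ m := by
      intro m hm
      induction m, hm using Nat.le_induction with
      | base => norm_num
      | succ m hm ih =>
        have h3 : 2 * m + 1 ≤ m ^ 2 := by nlinarith
        have e1 : (m + 1) ^ 2 = m ^ 2 + (2 * m + 1) := by ring
        have e2 : 2 ^ (m + 1) = 2 ^ m * 2 := pow_succ 2 m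
        rw [e1, e2]
        omega
    exact key L (by omega)
  refine ⟨?_, ?_, ?_, ?_⟩
  · -- `2ℓ ≤ 2(C+5)(L+1) ≤ L² ≤ 2^L ≤ n`
    have : 2 * ℓ ≤ 2 * (C + 5) * (L + 1) := by
      show 2 * ((C + 4) * (L + 1) + 1) ≤ 2 * (C + 5) * (L + 1)
      nlinarith
    omega
  · have h1 : n ^ (C + 3) < (2 ^ (L + 1)) ^ (C + 3) := Nat.pow_lt_pow_left hnL (by omega)
    rw [← pow_mul] at h1
    have e : 2 * n ^ 2 * n ^ (C + 1) = 2 * n ^ (C + 3) := by ring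
    have et : 2 ^ t = 2 ^ ((L + 1) * (C + 3)) * 2 := by
      show 2 ^ ((C + 3) * (L + 1) + 1) = _
      rw [pow_succ, Nat.mul_comm (C + 3)]
    rw [e, et]
    omega
  · have h1 : n ^ (C + 4) < (2 ^ (L + 1)) ^ (C + 4) := Nat.pow_lt_pow_left hnL (by omega)
    rw [← pow_mul] at h1
    have e : 2 * n ^ 3 * n ^ (C + 1) = 2 * n ^ (C + 4) := by ring
    have el : 2 ^ ℓ = 2 ^ ((L + 1) * (C + 4)) * 2 := by
      show 2 ^ ((C + 4) * (L + 1) + 1) = _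
      rw [pow_succ, Nat.mul_comm (C + 4)]
    rw [e, el]
    omega
  · have ht : t ≤ (C + 5) * (L + 1) := by
      show (C + 3) * (L + 1) + 1 ≤ (C + 5) * (L + 1)
      nlinarith
    have hl : ℓ ≤ (C + 5) * (L + 1) := by
      show (C + 4) * (L + 1) + 1 ≤ (C + 5) * (L + 1)
      nlinarith
    calc t * (2 * (2 * ℓ)) = (2 * t) * (2 * ℓ) := by ring
      _ ≤ (2 * ((C + 5) * (L + 1))) * (2 * ((C + 5) * (L + 1))) :=
          Nat.mul_le_mul (Nat.mul_le_mul_left _ ht) (Nat.mul_le_mul_left _ hl)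
      _ = (2 * (C + 5) * (L + 1)) * (2 * (C + 5) * (L + 1)) := by ring
      _ ≤ L ^ 2 * L ^ 2 := Nat.mul_le_mul hkey hkey
      _ = L ^ 4 := by ring

/-- **THE SYMMETRISATION LAW, hard direction**: covariant one-polynomial loss ⟹ `PolyLossOddU3` (exponent
`C ↦ C+1`, degree exponent `c ↦ max c 4 + 1`, threshold `max n₀ 2^(2C+11)`): elect a leader with
`RingLeaderElection3.exists_election3` (parameters from `election_params`), symmetrise with `symmetrization3`,
and absorb the bad set `2ⁿ/n^(C+2)` into the loss. -/
theorem polyLossOddU3_of_cov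
    (h : ∃ C : ℕ, ∀ c : ℕ, ∃ n₀ : ℕ, ∀ n ≥ n₀, ∀ Q : CubeFn (ZMod 3) n,
        Q ∈ lowDeg (ZMod 3) n ((Nat.log 2 n) ^ c) →
          ((univ.filter fun x : Fin n → Bool => OddZeros x ∧ RingHLF.Rel x (cov Q x)).card : ℝ) ≤
            (1 - 1 / (n : ℝ) ^ C) * (2 : ℝ) ^ (n - 1)) :
    Theses.ExactnessDial.PolyLossOddU3 := by
  obtain ⟨C, hC⟩ := h
  refine ⟨C + 1, fun c => ?_⟩
  obtain ⟨n₁, hn₁⟩ := hC (max c 4 + 1)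
  refine ⟨max n₁ (2 ^ (2 * C + 11)), fun n hn P hP => ?_⟩
  have hn₁' : n₁ ≤ n := le_trans (le_max_left _ _) hn
  have hnC : 2 ^ (2 * C + 11) ≤ n := le_trans (le_max_right _ _) hn
  have hn2 : 2 ≤ n := by
    have h2 : 2 ^ 1 ≤ 2 ^ (2 * C + 11) := Nat.pow_le_pow_right (by norm_num) (by omega)
    have h3 : 2 ^ 1 = 2 := rfl
    omega
  have hn0 : 0 < n := by omega
  obtain ⟨h2l, ht, hl, hdeg⟩ := election_params C n hnC
  set L := Nat.log 2 n with hL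
  obtain ⟨e, he, he01, hbad⟩ := RingLeaderElection3.exists_election3 hn0 h2l ht hl
  have hL2 : 2 ≤ L := Nat.le_log_of_pow_le (by norm_num) (show 2 ^ 2 ≤ n by
    exact le_trans (Nat.pow_le_pow_right (by norm_num) (by omega)) hnC)
  -- degree bookkeeping: `L^c + 4tℓ ≤ L^c + L^4 ≤ L^(max c 4 + 1)`
  have hdeg' : L ^ c + ((C + 3) * (L + 1) + 1) * (2 * (2 * ((C + 4) * (L + 1) + 1))) ≤
      L ^ (max c 4 + 1) := by
    have h1 : L ^ c ≤ L ^ max c 4 := Nat.pow_le_pow_right (by omega) (le_max_left _ _)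
    have h2 : L ^ 4 ≤ L ^ max c 4 := Nat.pow_le_pow_right (by omega) (le_max_right _ _)
    calc L ^ c + ((C + 3) * (L + 1) + 1) * (2 * (2 * ((C + 4) * (L + 1) + 1)))
        ≤ L ^ max c 4 + L ^ max c 4 := Nat.add_le_add h1 (hdeg.trans h2)
      _ = 2 * L ^ max c 4 := by ring
      _ ≤ L * L ^ max c 4 := Nat.mul_le_mul_right _ hL2
      _ = L ^ (max c 4 + 1) := by ring
  set W : ℝ := (1 - 1 / (n : ℝ) ^ C) * (2 : ℝ) ^ (n - 1) with hW
  have hE : ∀ Q : CubeFn (ZMod 3) n, Q ∈ lowDeg (ZMod 3) n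
      (L ^ c + ((C + 3) * (L + 1) + 1) * (2 * (2 * ((C + 4) * (L + 1) + 1)))) →
      ((univ.filter fun x : Fin n → Bool => OddZeros x ∧ RingHLF.Rel x (cov Q x)).card : ℝ) ≤ W :=
    fun Q hQ => hn₁ n hn₁' Q (lowDeg_mono hdeg' hQ)
  have hmain := symmetrization3 hn0 he he01 W hE P hP
  -- the bad set: `#Bad · n^(C+2) ≤ 2^n = 2 · 2^(n-1)`
  set Bad := (univ.filter fun x : Fin n → Bool => RingLeaderElection3.fireCount3 e x ≠ 1).card with hBad
  have hbadR : (Bad : ℝ) * ((n : ℝ) * (n : ℝ) ^ (C + 1)) ≤ (2 : ℝ) ^ n := by exact_mod_cast hbad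
  have hnR : (2 : ℝ) ≤ n := by exact_mod_cast hn2
  have hA : (2 : ℝ) ^ n = 2 * (2 : ℝ) ^ (n - 1) := by
    rw [← pow_succ']; congr 1; omega
  set A : ℝ := (2 : ℝ) ^ (n - 1) with hA'
  have hApos : 0 < A := by positivity
  set q : ℝ := (n : ℝ) ^ C with hq
  have hq1 : 1 ≤ q := one_le_pow₀ (by linarith)
  have hqpos : 0 < q := by linarith
  have hnpos : (0 : ℝ) < n := by linarith
  -- rewrite everything in terms of `A`, `q`, `N = n`
  have hW' : W = (1 - 1 / q) * A := rfl
  have hpow : (n : ℝ) ^ (C + 1) = q * n := by rw [hq, pow_succ]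
  rw [hpow, hA] at hbadR
  have hgoal : (1 - 1 / (n : ℝ) ^ (C + 1)) * (2 : ℝ) ^ (n - 1) = (1 - 1 / (q * n)) * A := by
    rw [hpow]
  rw [hgoal]
  -- `Bad ≤ 2A/(q n²)` and `2/(q n²) ≤ (1/q − 1/(q n))` since `n ≥ 2`
  have hBad_le : (Bad : ℝ) ≤ 2 * A / (q * n * n) := by
    rw [le_div_iff₀ (by positivity)]
    nlinarith
  have hkey : 2 * A / (q * n * n) ≤ (1 / q - 1 / (q * n)) * A := by
    rw [div_le_iff₀ (by positivity)]
    have hq0 : q ≠ 0 := hqpos.ne'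
    have hn0' : (n : ℝ) ≠ 0 := hnpos.ne'
    have e1 : (1 / q - 1 / (q * n)) * A * (q * n * n) = A * (n * n - n) := by
      field_simp
    rw [e1]
    have h3 : 0 ≤ A * ((n : ℝ) - 2) * ((n : ℝ) + 1) :=
      mul_nonneg (mul_nonneg hApos.le (by linarith)) (by linarith)
    nlinarith [h3]
  calc ((univ.filter fun x : Fin n → Bool =>
          OddZeros x ∧ RingHLF.Rel x (fun i => decide (P i x = 1))).card : ℝ)
      ≤ W + Bad := hmain
    _ ≤ (1 - 1 / q) * A + (1 / q - 1 / (q * n)) * A := by rw [hW']; linarith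
    _ = (1 - 1 / (q * n)) * A := by ring


/-- **THE SYMMETRISATION LAW** (one-polynomial normal form of the junction `ExactnessDial.PolyLossOddU3`,
stmt-QuantumAdvantage-26531): inverse-polynomial loss on the odd class against polylog-degree STRATEGIES is
equivalent to the same against ONE rotation-covariant polylog-degree POLYNOMIAL. -/
theorem polyLossOddU3_iff_cov :
    Theses.ExactnessDial.PolyLossOddU3 ↔
      ∃ C : ℕ, ∀ c : ℕ, ∃ n₀ : ℕ, ∀ n ≥ n₀, ∀ Q : CubeFn (ZMod 3) n,
        Q ∈ lowDeg (ZMod 3) n ((Nat.log 2 n) ^ c) →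
          ((univ.filter fun x : Fin n → Bool => OddZeros x ∧ RingHLF.Rel x (cov Q x)).card : ℝ) ≤
            (1 - 1 / (n : ℝ) ^ C) * (2 : ℝ) ^ (n - 1) :=
  ⟨cov_of_polyLossOddU3, polyLossOddU3_of_cov⟩

/-- ExactnessDial's `closes` from the JUNCTION alone on the exactness side: `PolyLossOddU3` discharges both
`NoPerfectOdd3` (26532, by `noPerfectOdd3_of_polyLossOddU3`) and `MassStep3u` (26533, trivially), and the
bridge is the landed `exactnessDial_multiRingBridge3`. -/
theorem exactnessDial_closes₃ (hPL : Theses.ExactnessDial.PolyLossOddU3) (hO : Theses.ExactnessDial.OddToAll3)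
    (hD : Theses.ExactnessDial.DPLift3) : Summit.QuantumAdvantage.AdviceFreeQNC0.AdviceFreeQNC0Three :=
  exactnessDial_closes₄ (noPerfectOdd3_of_polyLossOddU3 hPL) (fun _ => hPL) hO hD

/-- ExactnessDial's `closes` with the junction read for ONE COVARIANT POLYNOMIAL (the symmetrisation law)
and the bridge discharged: covariant inverse-polynomial loss, `OddToAll3` and `DPLift3` give the rung leaf. -/
theorem exactnessDial_closes_cov
    (hcov : ∃ C : ℕ, ∀ c : ℕ, ∃ n₀ : ℕ, ∀ n ≥ n₀, ∀ Q : CubeFn (ZMod 3) n,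
        Q ∈ lowDeg (ZMod 3) n ((Nat.log 2 n) ^ c) →
          ((univ.filter fun x : Fin n → Bool => OddZeros x ∧ RingHLF.Rel x (cov Q x)).card : ℝ) ≤
            (1 - 1 / (n : ℝ) ^ C) * (2 : ℝ) ^ (n - 1))
    (hO : Theses.ExactnessDial.OddToAll3) (hD : Theses.ExactnessDial.DPLift3) :
    Summit.QuantumAdvantage.AdviceFreeQNC0.AdviceFreeQNC0Three :=
  exactnessDial_closes₃ (polyLossOddU3_of_cov hcov) hO hD

/-- The same with the junction read for ONE COVARIANT POLYNOMIAL (symmetrisation law): covariant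
inverse-polynomial loss on the odd class and `DPLift3` give the rung leaf `AdviceFreeQNC0Three`. -/
theorem exactnessDial_closes_cov₂
    (hcov : ∃ C : ℕ, ∀ c : ℕ, ∃ n₀ : ℕ, ∀ n ≥ n₀, ∀ Q : CubeFn (ZMod 3) n,
        Q ∈ lowDeg (ZMod 3) n ((Nat.log 2 n) ^ c) →
          ((univ.filter fun x : Fin n → Bool => OddZeros x ∧ RingHLF.Rel x (cov Q x)).card : ℝ) ≤
            (1 - 1 / (n : ℝ) ^ C) * (2 : ℝ) ^ (n - 1))
    (hD : Theses.ExactnessDial.DPLift3) : Summit.QuantumAdvantage.AdviceFreeQNC0.AdviceFreeQNC0Three :=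
  exactnessDial_closes₂ (polyLossOddU3_of_cov hcov) hD

end RingSymmetrization3

end Summit.QuantumAdvantage.QuantumAdvantage.Theorems
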